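import Summits.AnomalousDissipation.AnomalousDissipation.Theorems.SawtoothPulseCascadeK1LocalisedCascadeKHSheetBlock

/-!
# K2 lane (route-2 `SawtoothPulseCascade`, crux dir `K1LocalisedCascade`): the sheet-block primitives in PRODUCT FORM

Helper file of the K2 lane (S2 table of `…KHSheetReduction`; ACL item stmt-AnomalousDissipation-19491). The two `M`-eigenvalues of the Gram
`m ∓ |S|` (`m = −Σ₀`, `S = S_β(k)`) are the halves of the tree's product-form Rayleigh denominators:

  `m + |S| = sinh πk / (2k (cosh πk − |cos πβ|))`,  `m − |S| = sinh πk / (2k (cosh πk + |cos πβ|))`   (`gram_eigenvalues_eq`),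

and the trace weight `W = (Am + E|S|²)/(m² − |S|²)` of `khForm_propagated_le_trace` is, in the product-form factors
`F₋ = π/2 − sinh πk/(k(cosh πk − |c|))`, `F₊ = π/2 − sinh πk/(k(cosh πk + |c|))` (`c = cos πβ`; `c²(k,β) = F₋F₊`, tree `sawC2_eq_sawC2prod`)
and `ρ = (cosh πk − |c|)/(cosh πk + |c|)`:

  `W = ½ (F₋² ρ + F₊² / ρ)`   (`sheetW_eq_productForm`; pure algebra `traceWeight_alpha_delta` in `α = m + |S|`, `δ = m − |S|`).

So the whole S2 table `2τ = 2(C² + Sn² k² W)` is a function of the three monotone primitives `F₋, F₊, ρ` of `(πk, |cos πβ|)` — the same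
primitives as the phase budget lemma S1. No definitions; no statement about the crux.
[cite: Drazin2002, §8.3 (8.36)–(8.38) (Rayleigh jump conditions at the kinks of a broken-line profile)] [problem: turb]
-/

-- `Summit.<Summit>.<Problem>`: single-conjunct summit, the duplicate namespace segment is deliberate.
set_option linter.dupNamespace false

noncomputable section

namespace Summit.AnomalousDissipation.AnomalousDissipation.Theorems.SawtoothPulseCascade.K2PhaseBudget

open Set Real Complex Literature.Analysis.FluidPDE.SawtoothCascade

/-- `|S_β(k)| = e^{−kπ}(1 − q)|cos πβ|/(k D₀)`, `D₀ = 1 − 2q cos 2πβ + q²`, `q = e^{−2πk}` (`k > 0`). [cite: Drazin2002, §8.3 (8.36)–(8.38)] -/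
theorem sqrt_normSq_sawS {k : ℝ} (hk : 0 < k) (β : ℝ) :
    Real.sqrt (Complex.normSq (sawS k β)) =
      Real.exp (-(k * π)) * (1 - sawQ k) * |Real.cos (π * β)| /
        (k * (1 - 2 * sawQ k * Real.cos (2 * π * β) + sawQ k ^ 2)) := by
  rw [normSq_sawS hk.ne' β]
  have hq1 : sawQ k < 1 := sawQ_lt_one hk
  have hq0 : 0 < sawQ k := sawQ_pos k
  have hc := Real.cos_le_one (2 * π * β)
  have hD : 0 < 1 - 2 * sawQ k * Real.cos (2 * π * β) + sawQ k ^ 2 := by nlinarith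
  have hcos2 : 2 + 2 * Real.cos (2 * π * β) = 4 * Real.cos (π * β) ^ 2 := by
    rw [show 2 * π * β = 2 * (π * β) by ring, Real.cos_two_mul]; ring
  have hsq : (Real.exp (-(k * π)) / (2 * k)) ^ 2 * ((1 - sawQ k) ^ 2 * (2 + 2 * Real.cos (2 * π * β))) /
      (1 - 2 * sawQ k * Real.cos (2 * π * β) + sawQ k ^ 2) ^ 2 =
      (Real.exp (-(k * π)) * (1 - sawQ k) * |Real.cos (π * β)| /
        (k * (1 - 2 * sawQ k * Real.cos (2 * π * β) + sawQ k ^ 2))) ^ 2 := by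
    conv_rhs => rw [div_pow, mul_pow, mul_pow, sq_abs]
    rw [hcos2]
    field_simp
    ring
  rw [hsq, Real.sqrt_sq]
  have : 0 ≤ Real.exp (-(k * π)) * (1 - sawQ k) * |Real.cos (π * β)| := by
    have := Real.exp_pos (-(k * π)); positivity
  positivity

/-- `−Σ₀(k,β) = sinh πk · cosh πk / (2k (cosh² πk − cos² πβ))` for `k > 0`. [cite: Drazin2002, §8.3 (8.36)–(8.38)] -/
theorem neg_sawSigma0_eq {k : ℝ} (hk : 0 < k) (β : ℝ) :
    -sawSigma0 k β = Real.sinh (π * k) * Real.cosh (π * k) / (2 * k * (Real.cosh (π * k) ^ 2 - Real.cos (π * β) ^ 2)) := by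
  unfold sawSigma0
  have hγ1 := Real.cos_le_one (π * β)
  have hγ2 := Real.neg_one_le_cos (π * β)
  have hE0 : 0 < Real.exp (π * k) := Real.exp_pos _
  have hE1 : 1 < Real.exp (π * k) := by
    have hx : 0 < π * k := by positivity
    have := Real.add_one_lt_exp hx.ne'
    linarith
  have hq : sawQ k = (Real.exp (π * k))⁻¹ ^ 2 := by
    rw [← Real.exp_neg, ← Real.exp_nat_mul]; unfold sawQ; congr 1; push_cast; ring
  have hsinh : Real.sinh (π * k) = (Real.exp (π * k) - (Real.exp (π * k))⁻¹) / 2 := by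
    rw [Real.sinh_eq, Real.exp_neg]
  have hcosh : Real.cosh (π * k) = (Real.exp (π * k) + (Real.exp (π * k))⁻¹) / 2 := by
    rw [Real.cosh_eq, Real.exp_neg]
  have hcos2 : Real.cos (2 * π * β) = 2 * Real.cos (π * β) ^ 2 - 1 := by
    rw [show 2 * π * β = 2 * (π * β) by ring, Real.cos_two_mul]
  rw [hq, hsinh, hcosh, hcos2]
  generalize Real.exp (π * k) = E at hE0 hE1 ⊢
  generalize Real.cos (π * β) = γ at hγ1 hγ2 ⊢
  have hE : E ≠ 0 := hE0.ne'
  have hk0 : k ≠ 0 := hk.ne'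
  have hsq : 0 < (E - 1) ^ 2 := by
    have : E - 1 ≠ 0 := by linarith
    positivity
  have hD : ((E + E⁻¹) / 2) ^ 2 - γ ^ 2 ≠ 0 := by
    have h1 : 1 < (E + E⁻¹) / 2 := by
      rw [lt_div_iff₀ (by norm_num : (0:ℝ) < 2)]
      have : E + E⁻¹ - 2 = (E - 1) ^ 2 / E := by field_simp; ring
      have : 0 < (E - 1) ^ 2 / E := by positivity
      linarith
    have h2 : γ ^ 2 ≤ 1 := by nlinarith
    have : 1 < ((E + E⁻¹) / 2) ^ 2 := by nlinarith
    linarith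
  have hD' : 1 - 2 * E⁻¹ ^ 2 * (2 * γ ^ 2 - 1) + (E⁻¹ ^ 2) ^ 2 ≠ 0 := by
    have : 1 - 2 * E⁻¹ ^ 2 * (2 * γ ^ 2 - 1) + (E⁻¹ ^ 2) ^ 2 = 4 * E⁻¹ ^ 2 * (((E + E⁻¹) / 2) ^ 2 - γ ^ 2) := by
      field_simp; ring
    rw [this]; positivity
  rw [neg_div, neg_neg,
    div_eq_div_iff (mul_ne_zero (mul_ne_zero two_ne_zero hk0) hD') (mul_ne_zero (mul_ne_zero two_ne_zero hk0) hD)]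
  field_simp
  ring

/-- `|S_β(k)| = sinh πk · |cos πβ| / (2k (cosh² πk − cos² πβ))` for `k > 0`. [cite: Drazin2002, §8.3 (8.36)–(8.38)] -/
theorem sqrt_normSq_sawS_eq {k : ℝ} (hk : 0 < k) (β : ℝ) :
    Real.sqrt (Complex.normSq (sawS k β)) =
      Real.sinh (π * k) * |Real.cos (π * β)| / (2 * k * (Real.cosh (π * k) ^ 2 - Real.cos (π * β) ^ 2)) := by
  rw [sqrt_normSq_sawS hk β]
  have hγ1 : |Real.cos (π * β)| ≤ 1 := Real.abs_cos_le_one _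
  have hγ0 : 0 ≤ |Real.cos (π * β)| := abs_nonneg _
  have hE0 : 0 < Real.exp (π * k) := Real.exp_pos _
  have hE1 : 1 < Real.exp (π * k) := by
    have hx : 0 < π * k := by positivity
    have := Real.add_one_lt_exp hx.ne'
    linarith
  have hq : sawQ k = (Real.exp (π * k))⁻¹ ^ 2 := by
    rw [← Real.exp_neg, ← Real.exp_nat_mul]; unfold sawQ; congr 1; push_cast; ring
  have hkp : Real.exp (-(k * π)) = (Real.exp (π * k))⁻¹ := by rw [mul_comm, Real.exp_neg]
  have hsinh : Real.sinh (π * k) = (Real.exp (π * k) - (Real.exp (π * k))⁻¹) / 2 := by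
    rw [Real.sinh_eq, Real.exp_neg]
  have hcosh : Real.cosh (π * k) = (Real.exp (π * k) + (Real.exp (π * k))⁻¹) / 2 := by
    rw [Real.cosh_eq, Real.exp_neg]
  have hcos2 : Real.cos (2 * π * β) = 2 * |Real.cos (π * β)| ^ 2 - 1 := by
    rw [show 2 * π * β = 2 * (π * β) by ring, Real.cos_two_mul, ← sq_abs]
  rw [← sq_abs (Real.cos (π * β)), hq, hkp, hsinh, hcosh, hcos2]
  generalize Real.exp (π * k) = E at hE0 hE1 ⊢
  generalize |Real.cos (π * β)| = γ at hγ1 hγ0 ⊢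
  have hE : E ≠ 0 := hE0.ne'
  have hk0 : k ≠ 0 := hk.ne'
  have hD : ((E + E⁻¹) / 2) ^ 2 - γ ^ 2 ≠ 0 := by
    have h1 : 1 < (E + E⁻¹) / 2 := by
      rw [lt_div_iff₀ (by norm_num : (0:ℝ) < 2)]
      have : E + E⁻¹ - 2 = (E - 1) ^ 2 / E := by field_simp; ring
      have hsq : 0 < (E - 1) ^ 2 := by
        have : E - 1 ≠ 0 := by linarith
        positivity
      have : 0 < (E - 1) ^ 2 / E := by positivity
      linarith
    have h2 : γ ^ 2 ≤ 1 := by nlinarith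
    have : 1 < ((E + E⁻¹) / 2) ^ 2 := by nlinarith
    linarith
  have hD' : 1 - 2 * E⁻¹ ^ 2 * (2 * γ ^ 2 - 1) + (E⁻¹ ^ 2) ^ 2 ≠ 0 := by
    have : 1 - 2 * E⁻¹ ^ 2 * (2 * γ ^ 2 - 1) + (E⁻¹ ^ 2) ^ 2 = 4 * E⁻¹ ^ 2 * (((E + E⁻¹) / 2) ^ 2 - γ ^ 2) := by
      field_simp; ring
    rw [this]; positivity
  rw [div_eq_div_iff (mul_ne_zero hk0 hD') (mul_ne_zero (mul_ne_zero two_ne_zero hk0) hD)]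
  field_simp
  ring

/-- **Gram eigenvalues in product form.** For `k > 0`: `m + |S| = sinh πk/(2k(cosh πk − |cos πβ|))` and
`m − |S| = sinh πk/(2k(cosh πk + |cos πβ|))`, `m = −Σ₀(k,β)`. [cite: Drazin2002, §8.3 (8.36)–(8.38)] -/
theorem gram_eigenvalues_eq {k : ℝ} (hk : 0 < k) (β : ℝ) :
    -sawSigma0 k β + Real.sqrt (Complex.normSq (sawS k β)) =
        Real.sinh (π * k) / (2 * k * (Real.cosh (π * k) - |Real.cos (π * β)|)) ∧
    -sawSigma0 k β - Real.sqrt (Complex.normSq (sawS k β)) =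
        Real.sinh (π * k) / (2 * k * (Real.cosh (π * k) + |Real.cos (π * β)|)) := by
  rw [neg_sawSigma0_eq hk β, sqrt_normSq_sawS_eq hk β, ← sq_abs (Real.cos (π * β))]
  have hx : 0 < π * k := by positivity
  have hC1 : 1 < Real.cosh (π * k) := Real.one_lt_cosh.2 hx.ne'
  have hγ1 : |Real.cos (π * β)| ≤ 1 := Real.abs_cos_le_one _
  have hγ0 : 0 ≤ |Real.cos (π * β)| := abs_nonneg _
  have hm : Real.cosh (π * k) - |Real.cos (π * β)| ≠ 0 := by
    have : 0 < Real.cosh (π * k) - |Real.cos (π * β)| := by linarith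
    exact this.ne'
  have hp : Real.cosh (π * k) + |Real.cos (π * β)| ≠ 0 := by
    have : 0 < Real.cosh (π * k) + |Real.cos (π * β)| := by linarith
    exact this.ne'
  have hk0 : k ≠ 0 := hk.ne'
  have hfac : Real.cosh (π * k) ^ 2 - |Real.cos (π * β)| ^ 2 =
      (Real.cosh (π * k) - |Real.cos (π * β)|) * (Real.cosh (π * k) + |Real.cos (π * β)|) := by ring
  rw [hfac]
  constructor
  · field_simp
  · field_simp

/-- Pure algebra: with `m = (α+δ)/2`, `|S| = (α−δ)/2`, `p = π/2 − 2m`, the trace weight `(Am + E|S|²)/(m² − |S|²)` equals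
`½((π/2 − 2α)² δ/α + (π/2 − 2δ)² α/δ)`. [folklore] -/
theorem traceWeight_alpha_delta {α δ : ℝ} (hα : 0 < α) (hδ : 0 < δ) :
    (((α + δ) / 2 * (π / 2 - 2 * ((α + δ) / 2)) ^ 2 + 4 * ((α - δ) / 2) ^ 2 * ((π / 2 - 2 * ((α + δ) / 2)) + (α + δ) / 2)) *
          ((α + δ) / 2) +
        ((π / 2 - 2 * ((α + δ) / 2)) ^ 2 + 4 * ((α + δ) / 2) * (π / 2 - 2 * ((α + δ) / 2)) + 4 * ((α - δ) / 2) ^ 2) *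
          ((α - δ) / 2) ^ 2) /
        (((α + δ) / 2) ^ 2 - ((α - δ) / 2) ^ 2) =
      ((π / 2 - 2 * α) ^ 2 * (δ / α) + (π / 2 - 2 * δ) ^ 2 * (α / δ)) / 2 := by
  have hαδ : ((α + δ) / 2) ^ 2 - ((α - δ) / 2) ^ 2 = α * δ := by ring
  rw [hαδ]
  field_simp
  ring

/-- **The trace weight in product form.** For `k > 0`, with `m = −Σ₀`, `t = |S|²`, `p = π/2 − 2m` (the data of
`khForm_propagated_le_trace`), `F∓ = π/2 − sinh πk/(k(cosh πk ∓ |cos πβ|))` and `ρ = (cosh πk − |cos πβ|)/(cosh πk + |cos πβ|)`: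
`(Am + Et)/(m² − t) = ½(F₋² ρ + F₊²/ρ)`. [cite: Drazin2002, §8.3 (8.36)–(8.38)] -/
theorem sheetW_eq_productForm {k : ℝ} (hk : 0 < k) (β : ℝ) {m : ℝ} (hm : m = -sawSigma0 k β) :
    ((m * (π / 2 - 2 * m) ^ 2 + 4 * Complex.normSq (sawS k β) * ((π / 2 - 2 * m) + m)) * m +
          ((π / 2 - 2 * m) ^ 2 + 4 * m * (π / 2 - 2 * m) + 4 * Complex.normSq (sawS k β)) * Complex.normSq (sawS k β)) /
        (m ^ 2 - Complex.normSq (sawS k β)) =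
      ((π / 2 - Real.sinh (π * k) / (k * (Real.cosh (π * k) - |Real.cos (π * β)|))) ^ 2 *
            ((Real.cosh (π * k) - |Real.cos (π * β)|) / (Real.cosh (π * k) + |Real.cos (π * β)|)) +
          (π / 2 - Real.sinh (π * k) / (k * (Real.cosh (π * k) + |Real.cos (π * β)|))) ^ 2 *
            ((Real.cosh (π * k) + |Real.cos (π * β)|) / (Real.cosh (π * k) - |Real.cos (π * β)|))) / 2 := by
  obtain ⟨hplus, hminus⟩ := gram_eigenvalues_eq hk β
  set s := Real.sqrt (Complex.normSq (sawS k β)) with hs_def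
  have hs0 : 0 ≤ s := Real.sqrt_nonneg _
  have ht : Complex.normSq (sawS k β) = s ^ 2 := (Real.sq_sqrt (Complex.normSq_nonneg _)).symm
  set α := m + s with hα_def
  set δ := m - s with hδ_def
  have hx : 0 < π * k := by positivity
  have hC1 : 1 < Real.cosh (π * k) := Real.one_lt_cosh.2 hx.ne'
  have hγ1 : |Real.cos (π * β)| ≤ 1 := Real.abs_cos_le_one _
  have hsh : 0 < Real.sinh (π * k) := Real.sinh_pos_iff.2 hx
  have hdm : 0 < Real.cosh (π * k) - |Real.cos (π * β)| := by linarith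
  have hdp : 0 < Real.cosh (π * k) + |Real.cos (π * β)| := by linarith [abs_nonneg (Real.cos (π * β))]
  have hα' : α = Real.sinh (π * k) / (2 * k * (Real.cosh (π * k) - |Real.cos (π * β)|)) := by
    rw [hα_def, hm, hs_def]; exact hplus
  have hδ' : δ = Real.sinh (π * k) / (2 * k * (Real.cosh (π * k) + |Real.cos (π * β)|)) := by
    rw [hδ_def, hm, hs_def]; exact hminus
  have hα0 : 0 < α := by rw [hα']; positivity
  have hδ0 : 0 < δ := by rw [hδ']; positivity
  have hm' : m = (α + δ) / 2 := by rw [hα_def, hδ_def]; ring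
  have hs' : Complex.normSq (sawS k β) = ((α - δ) / 2) ^ 2 := by rw [ht, hα_def, hδ_def]; ring
  rw [hs', hm', traceWeight_alpha_delta hα0 hδ0]
  -- identify `π/2 − 2α = F₋`, `π/2 − 2δ = F₊`, `δ/α = ρ`, `α/δ = 1/ρ`
  have hk0 : k ≠ 0 := hk.ne'
  have h1 : π / 2 - 2 * α = π / 2 - Real.sinh (π * k) / (k * (Real.cosh (π * k) - |Real.cos (π * β)|)) := by
    rw [hα']; field_simp
  have h2 : π / 2 - 2 * δ = π / 2 - Real.sinh (π * k) / (k * (Real.cosh (π * k) + |Real.cos (π * β)|)) := by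
    rw [hδ']; field_simp
  have h3 : δ / α = (Real.cosh (π * k) - |Real.cos (π * β)|) / (Real.cosh (π * k) + |Real.cos (π * β)|) := by
    rw [hα', hδ']; field_simp
  have h4 : α / δ = (Real.cosh (π * k) + |Real.cos (π * β)|) / (Real.cosh (π * k) - |Real.cos (π * β)|) := by
    rw [hα', hδ']; field_simp
  rw [h1, h2, h3, h4]

end Summit.AnomalousDissipation.AnomalousDissipation.Theorems.SawtoothPulseCascade.K2PhaseBudget

end
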